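import Summits.QuantumFields.GaugeBoot.PeriodicLoopEquation
import Summits.QuantumFields.GaugeBoot.LoopEquationSchema
import Summits.QuantumFields.GaugeBoot.TiltedBox
import HarnessLib

/-!
# Loop-equation schema on a periodic lattice: occurrence detection on `ℤ^d` (gauge-boot, periodic loop equations, schema)

HONEST FRAMING (cell `pub-gaugeboot`, page 1 of every file): the venture produces certified bounds
on lattice expectations at stated coupling, gauge group, dimension and torus size; NOT a mass gap,
NOT a continuum limit, NOT a string tension; NOT Yang–Mills-summit-bearing (barriers
`FixedCouplingUltralocality`, `PerturbativeInvisibility`).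

The analogue of `LoopEquationSchema.lean` for the periodic lattice `(A, e)` of
`TiltedLatticeGauge.lean`. The split terms `splitTerm_k` of `PeriodicLoopEquation.lean` ask whether
the `k`-th letter of the word traverses the link `(x, μ)` — a SITE equality in `A`, which depends on
the lattice. For fixed words (the rows of a certificate, valid on every box of size `≥ L₀`) it is
decided ON `ℤ^d`, reusing the integer displacements `Word.dispZ`, the decidable occurrence predicates
`Word.fwdOccZ / bwdOccZ` and the displacement bound `Word.DispBound` of the torus schema file:

* `castE e : ℤ^d →+ A`, `v ↦ Σ_k v_k • e_k`; `Word.siteAt_eq_add_castE` — the `k`-th visited site is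
  `x + castE e (dispZ w k)`;
* `Word.SmallFor e w` — the partial displacements of `w` that vanish (resp. equal a unit vector) in `A`
  already do so in `ℤ^d`; then returns to `x` / to `x + e_μ` in `A` are exactly the returns on `ℤ^d`
  (`Word.siteAt_eq_iff_of_smallFor`, `Word.siteAt_sub_eq_iff_of_smallFor`) and
  `splitTerm_eq_of_smallFor` computes the split terms from the word alone;
* `loopEquation_schema` / `loopEquation_schema_specialUnitaryGroup` — the periodic loop equation with
  the split sums over the COMPUTED occurrence sets `(range |w|).filter (fwdOccZ w μ)` / `… bwdOccZ …`;
* the 45°-tilted box: `castE tiltedUnit v = [v]` (`castE_tiltedUnit`) and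
  **`smallFor_tiltedUnit_of_dispBound`** — a word with displacement bound `B` is small for every
  tilted box with `B + 1 < M_u`, `B + 1 < M_v`, `B + 2 ≤ L` (the three congruences defining `Γ` cannot
  hold for a non-zero vector that small), so each row of a tilted-box certificate is one
  instantiation with `decide`, exactly as on the cubic torus.

Everything is `[folklore]`.

References: V. Kazakov, Z. Zheng, arXiv:2404.16925 §2.3; S. Cao, M. Park, S. Sheffield, Comm. AMS 5
(2025), Thm. 5.7 (`U(N)`) / Thm. 6.104 (`SU(N)`) (arXiv:2307.06790 numbering; informally Thm. 1.14).
-/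

noncomputable section

open MeasureTheory Filter Topology NormedSpace
open scoped Matrix.Norms.Frobenius Matrix
open Literature.MathematicalPhysics.QuantumFieldTheory (LatticeRep)
open Literature.MathematicalPhysics.QuantumLattice (fundamentalRep fundamentalLatticeRep)

namespace Summit.QuantumFields.GaugeBoot

namespace TiltedRP

variable {A : Type} [AddCommGroup A] {d N : ℕ} {G : Type} [Group G] {ρ : G →* Matrix (Fin N) (Fin N) ℂ}

/-! ### Integer displacements read in `A` -/

section Cast

variable (e : Fin d → A)

/-- The homomorphism `ℤ^d → A`, `v ↦ Σ_k v_k • e_k` (the integer lattice read in the periodic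
lattice). [folklore] -/
def castE : (Fin d → ℤ) →+ A where
  toFun v := ∑ k, v k • e k
  map_zero' := by simp
  map_add' u v := by simp [add_zsmul, Finset.sum_add_distrib]

/-- Unfolding lemma `castE_apply`. [folklore] -/
theorem castE_apply (v : Fin d → ℤ) : castE e v = ∑ k, v k • e k := rfl

/-- `castE` of a unit vector is the marked translation. [folklore] -/
@[simp] theorem castE_single (μ : Fin d) : castE e (Pi.single μ (1 : ℤ)) = e μ := by
  rw [castE_apply, Finset.sum_eq_single μ (fun k _ hk => by rw [Pi.single_eq_of_ne hk, zero_zsmul])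
    (fun h => (h (Finset.mem_univ μ)).elim), Pi.single_eq_same, one_zsmul]

/-- A step moves the site by `castE` of its integer displacement. [folklore] -/
theorem move_eq_add_castE (x : A) (s : Step d) : s.move e x = x + castE e s.dispZ := by
  cases s with
  | fwd μ => simp [Step.move, Step.dispZ]
  | bwd μ => simp [Step.move, Step.dispZ, map_neg, sub_eq_add_neg]

/-- The `k`-th visited site is the base point plus `castE` of the integer displacement. [folklore] -/
theorem Word.siteAt_eq_add_castE (x : A) : ∀ (w : Word d) (k : ℕ),
    Word.siteAt e x w k = x + castE e (w.dispZ k)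
  | [], k => by simp [Word.siteAt]
  | s :: w, 0 => by simp
  | s :: w, k + 1 => by
    rw [Word.siteAt_succ_cons, Word.siteAt_eq_add_castE (s.move e x) w k,
      GaugeBoot.Word.dispZ_cons_succ, map_add, move_eq_add_castE, add_assoc]

/-- The word is SMALL for the periodic lattice `(A, e)`: every partial displacement that vanishes in
`A` (resp. equals a marked translation `e μ` in `A`) already vanishes (resp. equals the unit vector)
in `ℤ^d` — so that returns to the base point and to `x + e_μ` are decided on `ℤ^d`. [shape] A parametric
predicate on words organising the schema — NOT a named fact. [folklore] -/
def Word.SmallFor (w : Word d) : Prop :=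
  ∀ k, (castE e (w.dispZ k) = 0 → w.dispZ k = 0) ∧
    ∀ μ : Fin d, castE e (w.dispZ k) = e μ → w.dispZ k = Pi.single μ 1

/-- For a small word, "back at `x`" is decided on `ℤ^d`. [folklore] -/
theorem Word.siteAt_eq_iff_of_smallFor {w : Word d} (hw : Word.SmallFor e w) (x : A) (k : ℕ) :
    Word.siteAt e x w k = x ↔ w.dispZ k = 0 := by
  rw [Word.siteAt_eq_add_castE, add_eq_left]
  exact ⟨(hw k).1, fun h => by rw [h, map_zero]⟩

/-- For a small word, "at `x + e_μ`" is decided on `ℤ^d`. [folklore] -/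
theorem Word.siteAt_sub_eq_iff_of_smallFor {w : Word d} (hw : Word.SmallFor e w) (x : A) (k : ℕ)
    (μ : Fin d) : Word.siteAt e x w k - e μ = x ↔ w.dispZ k = Pi.single μ 1 := by
  rw [sub_eq_iff_eq_add, Word.siteAt_eq_add_castE, add_right_inj]
  exact ⟨(hw k).2 μ, fun h => by rw [h, castE_single]⟩

variable [DecidableEq A]

variable (ρ) in
/-- **Split terms decided on `ℤ^d`** (periodic lattice). For a small word the `k`-th split term is
the forward term if `fwdOccZ`, minus the backward term if `bwdOccZ`, else `0`. [folklore] -/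
theorem splitTerm_eq_of_smallFor {w : Word d} (hw : Word.SmallFor e w) (s : ℂ) (x : A) (μ : Fin d)
    (U : Config A d G) (k : ℕ) :
    splitTerm ρ e s x μ U w k =
      if w.fwdOccZ μ k then
        (ρ (wordHolonomy e U x (w.take k))).trace *
            (ρ (wordHolonomy e U (Word.siteAt e x w k) (w.drop k))).trace -
          (s / N) * (ρ (wordHolonomy e U x w)).trace
      else if w.bwdOccZ μ k then
        -((ρ (wordHolonomy e U x (w.take (k + 1)))).trace *
            (ρ (wordHolonomy e U (Word.siteAt e x w (k + 1)) (w.drop (k + 1)))).trace -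
          (s / N) * (ρ (wordHolonomy e U x w)).trace)
      else 0 := by
  unfold splitTerm GaugeBoot.Word.fwdOccZ GaugeBoot.Word.bwdOccZ
  split
  · next hk => simp [hk]
  · next st hk =>
    cases st with
    | fwd ν =>
      by_cases hν : ν = μ
      · subst hν
        simp only [Step.link_fwd, Prod.mk.injEq, and_true, Step.isFwd_fwd, if_true, hk, Option.some.injEq,
          true_and, Word.siteAt_eq_iff_of_smallFor e hw, reduceCtorEq, false_and, if_false]
      · simp [hν, hk]
    | bwd ν =>
      by_cases hν : ν = μ
      · subst hν
        simp only [Step.link_bwd, Prod.mk.injEq, and_true, Step.isFwd_bwd, Bool.false_eq_true, if_false, hk,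
          Option.some.injEq, Word.siteAt_sub_eq_iff_of_smallFor e hw, reduceCtorEq, false_and, true_and]
      · simp [hν, hk]

end Cast

/-! ### The schema -/

section Schema

variable [DecidableEq A] [Fintype A] [TopologicalSpace G] [IsTopologicalGroup G] [CompactSpace G]
  [MeasurableSpace G] [BorelSpace G] (r : LatticeRep G) (e : Fin d → A)

/-- **THE LOOP-EQUATION SCHEMA on a periodic lattice.** For a word `w` closed at `x` and small for
`(A, e)`, the single-link loop equation at `(x, μ)` reads
`Σ_{k : fwdOccZ} E[tr A_k tr B_k − (s/N) tr W] − Σ_{k : bwdOccZ} E[tr A'_k tr B'_k − (s/N) tr W]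
+ (β/2) Σ_{ν≠μ,ε} E[plaqTerm_{ν,ε}] = 0`, the occurrence sets COMPUTED from the word on `ℤ^d`.
[folklore] -/
theorem loopEquation_schema (β : ℝ) (x : A) (μ : Fin d) (s : ℂ) (w : Word d)
    (hw : Word.endpoint e x w = x) (hsm : Word.SmallFor e w)
    (hP : ∀ i j : Fin r.N, SDPair r e β x μ x w (unitDir s i j)) :
    (∑ k ∈ (Finset.range w.length).filter (w.fwdOccZ μ),
        ∫ U, ((r.ρ (wordHolonomy e U x (w.take k))).trace *
            (r.ρ (wordHolonomy e U (Word.siteAt e x w k) (w.drop k))).trace -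
          (s / r.N) * (r.ρ (wordHolonomy e U x w)).trace) ∂(gibbs r.ρ e β)) -
      (∑ k ∈ (Finset.range w.length).filter (w.bwdOccZ μ),
        ∫ U, ((r.ρ (wordHolonomy e U x (w.take (k + 1)))).trace *
            (r.ρ (wordHolonomy e U (Word.siteAt e x w (k + 1)) (w.drop (k + 1)))).trace -
          (s / r.N) * (r.ρ (wordHolonomy e U x w)).trace) ∂(gibbs r.ρ e β)) +
      (β / 2 : ℂ) * ∑ ν ∈ Finset.univ.erase μ, ∑ ε : Bool,
        ∫ U, plaqTerm r.ρ e s x μ U w ν ε ∂(gibbs r.ρ e β) = 0 := by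
  have h := loopEquation_of_sdPair e r β x μ s w hw hP
  have hsplit : ∀ k, ∫ U, splitTerm r.ρ e s x μ U w k ∂(gibbs r.ρ e β) =
      (if w.fwdOccZ μ k then
        ∫ U, ((r.ρ (wordHolonomy e U x (w.take k))).trace *
            (r.ρ (wordHolonomy e U (Word.siteAt e x w k) (w.drop k))).trace -
          (s / r.N) * (r.ρ (wordHolonomy e U x w)).trace) ∂(gibbs r.ρ e β) else 0) -
      (if w.bwdOccZ μ k then
        ∫ U, ((r.ρ (wordHolonomy e U x (w.take (k + 1)))).trace *
            (r.ρ (wordHolonomy e U (Word.siteAt e x w (k + 1)) (w.drop (k + 1)))).trace -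
          (s / r.N) * (r.ρ (wordHolonomy e U x w)).trace) ∂(gibbs r.ρ e β) else 0) := by
    intro k
    rw [integral_congr_ae (ae_of_all _ fun U => splitTerm_eq_of_smallFor r.ρ e hsm s x μ U k)]
    by_cases hf : w.fwdOccZ μ k
    · have hb : ¬ w.bwdOccZ μ k := fun hb => by
        have h1 := hf.1; have h2 := hb.1; rw [h1] at h2; simp at h2
      simp only [hf, hb, if_true, if_false, sub_zero]
    · by_cases hb : w.bwdOccZ μ k
      · simp only [hf, hb, if_true, if_false, integral_neg, zero_sub]
      · simp only [hf, hb, if_false, integral_zero, sub_zero]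
  simp_rw [hsplit, Finset.sum_sub_distrib, Finset.sum_ite, Finset.sum_const_zero, add_zero] at h
  exact h

/-- `SU(N)` form of the periodic schema. [folklore] -/
theorem loopEquation_schema_specialUnitaryGroup (N : ℕ) (β : ℝ) (x : A) (μ : Fin d) (w : Word d)
    (hw : Word.endpoint e x w = x) (hsm : Word.SmallFor e w) :
    (∑ k ∈ (Finset.range w.length).filter (w.fwdOccZ μ),
        ∫ U, ((fundamentalRep (Fin N) (wordHolonomy e U x (w.take k))).trace *
            (fundamentalRep (Fin N) (wordHolonomy e U (Word.siteAt e x w k) (w.drop k))).trace -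
          (1 / N) * (fundamentalRep (Fin N) (wordHolonomy e U x w)).trace)
          ∂(gibbs (fundamentalRep (Fin N)) e β)) -
      (∑ k ∈ (Finset.range w.length).filter (w.bwdOccZ μ),
        ∫ U, ((fundamentalRep (Fin N) (wordHolonomy e U x (w.take (k + 1)))).trace *
            (fundamentalRep (Fin N) (wordHolonomy e U (Word.siteAt e x w (k + 1)) (w.drop (k + 1)))).trace -
          (1 / N) * (fundamentalRep (Fin N) (wordHolonomy e U x w)).trace)
          ∂(gibbs (fundamentalRep (Fin N)) e β)) +
      (β / 2 : ℂ) * ∑ ν ∈ Finset.univ.erase μ, ∑ ε : Bool,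
        ∫ U, plaqTerm (fundamentalRep (Fin N)) e 1 x μ U w ν ε ∂(gibbs (fundamentalRep (Fin N)) e β) = 0 :=
  loopEquation_schema (fundamentalLatticeRep N) e β x μ 1 w hw hsm
    fun i j => sdPair_specialUnitaryGroup N e β x μ x w _ (trace_unitDir_one i j)

end Schema

/-! ### Smallness on the 45°-tilted box -/

section Box

variable (d : ℕ) {i j : Fin d} (Mu Mv L : ℕ)

/-- On the tilted box, `castE` of an integer vector is its class. [folklore] -/
theorem castE_tiltedUnit (v : Fin d → ℤ) :
    castE (tiltedUnit d i j Mu Mv L) v = ((v : Fin d → ℤ) : TiltedSite d i j Mu Mv L) := by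
  rw [castE_apply]
  have hv : v = ∑ k, v k • (Pi.single k (1 : ℤ) : Fin d → ℤ) := by
    funext m
    simp only [Finset.sum_apply, Pi.smul_apply, Pi.single_apply, smul_eq_mul, mul_ite, mul_one, mul_zero,
      Finset.sum_ite_eq, Finset.mem_univ, if_true]
  conv_rhs => rw [hv]
  rw [show (((∑ k, v k • (Pi.single k (1 : ℤ) : Fin d → ℤ)) : Fin d → ℤ) : TiltedSite d i j Mu Mv L) =
    QuotientAddGroup.mk' (tiltedLattice d i j Mu Mv L) (∑ k, v k • (Pi.single k (1 : ℤ) : Fin d → ℤ))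
    from rfl, map_sum]
  simp only [map_zsmul]
  rfl

/-- An integer vector of sup-norm `< M_u, M_v, L` (in the relevant components) that lies in `Γ` is zero.
[folklore] -/
theorem eq_zero_of_mem_tiltedLattice_of_small (hij : i ≠ j) {u : Fin d → ℤ} {C : ℕ}
    (hC : ∀ m, |u m| ≤ C) (hu : C < Mu) (hv : C < Mv) (hL : C < L)
    (hmem : u ∈ tiltedLattice d i j Mu Mv L) : u = 0 := by
  rw [mem_tiltedLattice_iff] at hmem
  obtain ⟨h1, h2, h3⟩ := hmem
  have hi := hC i
  have hj := hC j
  have hs : u i + u j = 0 := by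
    refine Int.eq_zero_of_abs_lt_dvd h1 ?_
    calc |u i + u j| ≤ |u i| + |u j| := abs_add_le _ _
      _ < ((2 * Mu : ℕ) : ℤ) := by push_cast; omega
  have hd : u i - u j = 0 := by
    refine Int.eq_zero_of_abs_lt_dvd h2 ?_
    calc |u i - u j| ≤ |u i| + |u j| := abs_sub _ _
      _ < ((2 * Mv : ℕ) : ℤ) := by push_cast; omega
  funext m
  by_cases hmi : m = i
  · subst hmi; simp only [Pi.zero_apply]; omega
  by_cases hmj : m = j
  · subst hmj; simp only [Pi.zero_apply]; omega
  have hm := hC m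
  exact Int.eq_zero_of_abs_lt_dvd (h3 m hmi hmj) (by omega)

/-- **A word with displacement bound `B` is small for every tilted box with `B + 1 < M_u`,
`B + 1 < M_v`, `B + 2 ≤ L`.** So the occurrence sets of a fixed row are decided on `ℤ^d` for all
boxes beyond an explicit size. [folklore] -/
theorem smallFor_tiltedUnit_of_dispBound (hij : i ≠ j) {w : Word d} {B : ℕ} (h : w.DispBound B)
    (hu : B + 1 < Mu) (hv : B + 1 < Mv) (hL : B + 2 ≤ L) :
    Word.SmallFor (tiltedUnit d i j Mu Mv L) w := by
  have hB : ∀ k m, |w.dispZ k m| ≤ (B : ℤ) := by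
    intro k m
    have hk : (w.dispZ k m).natAbs ≤ B := by
      by_cases hkl : k ≤ w.length
      · exact h k hkl m
      · rw [w.dispZ_of_length_le (le_of_not_ge hkl)]; exact h _ le_rfl m
    rw [Int.abs_eq_natAbs]; exact_mod_cast hk
  intro k
  refine ⟨fun h0 => ?_, fun μ hμ => ?_⟩
  · rw [castE_tiltedUnit, QuotientAddGroup.eq_zero_iff] at h0
    exact eq_zero_of_mem_tiltedLattice_of_small d Mu Mv L hij (hB k) (by omega) (by omega) (by omega) h0
  · have h0 : castE (tiltedUnit d i j Mu Mv L) (w.dispZ k - Pi.single μ 1) = 0 := by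
      rw [map_sub, hμ, castE_single, sub_self]
    rw [castE_tiltedUnit, QuotientAddGroup.eq_zero_iff] at h0
    have hC : ∀ m, |(w.dispZ k - Pi.single μ 1 : Fin d → ℤ) m| ≤ (B + 1 : ℕ) := by
      intro m
      have h1 : |(Pi.single μ (1 : ℤ) : Fin d → ℤ) m| ≤ 1 := by
        by_cases hm : m = μ
        · subst hm; simp
        · simp [hm]
      have h2 := abs_sub (w.dispZ k m) ((Pi.single μ (1 : ℤ) : Fin d → ℤ) m)
      have h3 := hB k m
      rw [Pi.sub_apply]
      push_cast
      linarith
    have hz := eq_zero_of_mem_tiltedLattice_of_small d Mu Mv L hij hC (by omega) (by omega) (by omega) h0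
    exact sub_eq_zero.1 hz

/-- Example (`d = 3`, the plaquette row in the `(i, j) = (0, 1)` plane of the tilted box): the word
`+0 +1 −0 −1` has displacement bound `1`, so it is small for every box with `M_u, M_v ≥ 3`, `L ≥ 3`,
and its occurrence sets for the link `(x, 0)` are `{0}` (forward) and `∅` (backward). [folklore] -/
example {Mu Mv L : ℕ} (hu : 3 ≤ Mu) (hv : 3 ≤ Mv) (hL : 3 ≤ L) :
    Word.SmallFor (tiltedUnit 3 (0 : Fin 3) 1 Mu Mv L) (Word.plaquette (0 : Fin 3) 1) ∧
      ((Finset.range 4).filter ((Word.plaquette (0 : Fin 3) 1).fwdOccZ 0)) = {0} ∧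
      ((Finset.range 4).filter ((Word.plaquette (0 : Fin 3) 1).bwdOccZ 0)) = ∅ :=
  ⟨smallFor_tiltedUnit_of_dispBound 3 Mu Mv L (by decide) (by decide) (by omega) (by omega) hL,
    by decide, by decide⟩

end Box

end TiltedRP

end Summit.QuantumFields.GaugeBoot

end
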